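import Summits.QuantumFields.YangMills.Theorems.BalabanUVNodesN22NestedPolymersN22
import Summits.QuantumFields.YangMills.Theorems.BalabanUVNodesN22KernelLimitOfActivitySlots
import Literature.MathematicalPhysics.QuantumFieldTheory.Balaban1983to89.Beta.RemainderLimitTorus

/-!
# THE NESTED-POLYMERS TOWER — ★★★ dag-n22-w3 g3's ACTIVITY-SLOT ∕ (S≈) EXISTENCE THEOREM `polLimitsExist_localizedSum_of_activitySlots` (p607522) FIRES NON-DEGENERATELY
# (A6 lane, dag-n22-w3)

Cell `pub-ymgap`, Track A (HUMAN RULING D-0062), WIDTH SEAT `dag-n22-w3` g5 on node n22 = NE9, A6-residue lane; `--kind proof --supports stmt-QuantumFields-27366 --as helper` (KEY MAP v2: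
K3⁸), COUNT-NEUTRAL; THEOREMS ONLY (0 `def`, 0 `sorry`, standard axioms).  Sequel of this seat's nested-polymers chain `…N22NestedPolymers{Defs,KP,Terms,Limit,N22}`: there W1-19b's
(1.21)-existence letter, NE9∕`N22At`, `N18At` and (D4) hold at def-W1's `localizedSum F (nestedTower F M a) (originReading F)` DIRECTLY (hard schema + computed (2.13)).  HERE the
seat's g3 localizedSum-level CONDITIONAL theorem `polLimitsExist_localizedSum_of_activitySlots` (p607522; thirty-odd binders: W1's (2.38) value slot `Bound238` with Road-1 numerals,
per-term complexified probe readings `ιc ∕ Φ ∕ U`, activity holomorphy, the [I] p. 282 site-weight tails `hw ∕ hwB`, and the displayed law (S≈)) — so far inhabited ONLY by its own §3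
zero-tower ∕ zero-chart smoke test — is inhabited by the GENUINE tower at the NONZERO chart `ρ = id`, with window kernels NOT eventually constant.

THE POINT (why the reading-locality rows do not exclude the origin reading).  p607522's tails row asks the complexified probe reading of the term at `X` to weigh the site `t` by
`≤ B₃e^{−δ₀·dist(t, X)}`; the origin reading reads ONE site (the window origin).  Reading it with the WEIGHT `e^{−δ₀·dist(0, X)}` (`ιc K k X`) and un-weighting inside the chart
(`Φ K k X z := exp(e^{+δ₀·dist(0, X)} z)` smeared over the bonds) keeps the chart clause `Φ X (ιc X B) = originReading (exp B)` for EVERY `X` and meets the tails row with `B₃ = 1`;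
the space clause and the (2.38) slot only ever meet `Φ X z` at polymers `Z ⊆ X` of the tower, all of which contain the origin cube, where `dist(0, X) = 0` (§0) and `|exp z| ≤ e^r`.

* §0 `pl1_zero`, `distCT_zero_zero`, ★ `distCT_nearT_zero_eq_zero` (def-T's site geometry: the fine site `0` lies in the cube `0` — node00-def-β's `tcubeOf_zero` — at distance `0` from
  every domain containing it), `cast_siteOfInt_zero`.
* §1 ★ `bound238_nestedTower` (W1's (2.38) slot for the tower on the admissible spaces «`|𝐔(b₀)| ≤ e^r` if the domain contains the origin cube», amplitudes `≤ A e^{−r}e^{−R i}`, by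
  (2.30)'s upper half `torusTreeLen_le_card_sub_one`: `d(seg i) ≤ i`), ★ `differentiableOn_H_nestedTower` (activity holomorphy through any smeared exponential chart),
  `cexp_weight_unweight` (the chart clause), `norm_cexp_le_of_mem_ball` (the space clause).
* §2 ★ `approxStable_localizedSum_nestedTower` — (S≈) for the model (class «every domain small», as in p607522 §3): the all-domain window sums at consecutive volumes differ by
  `≤ Λ q^K` from a threshold on (closed form `[br]·ψ(Σ a)` of `…Limit` + `|ψ(A) − ψ(B)| ≤ |A − B|`).
* §3 ★★★ `polLimitsExist_localizedSum_of_activitySlots_fires_nestedTower` — p607522 APPLIED with every binder inhabited by the model (parametric in the amplitudes `0 ≤ a ≤ A e^{−r}e^{−R i}`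
  and in ANY numerals meeting its rows); ★ `roadOne_numerals_pos` (the numeral rows hold with `A > 0`); ★★ `polLimitsExist_localizedSum_of_activitySlots_fires_nestedTower_couplingAmplitudes`
  (for the scaled COUPLING-READING amplitude of `…N22`: strictly positive, p607522 fires, AND the origin-entry window kernels are not eventually constant — `…Limit`'s
  `not_eventuallyConst_polWindow_localizedSum_nestedTower`).

CONSUMES BY NAME (nothing re-declared): this seat's g3 `polLimitsExist_localizedSum_of_activitySlots` ∕ `kappa_four_smoke` (p607522); this seat's chain (`nestedTower`, `originReading`,
`segDom`, `H_nestedStep_segDom ∕ _eq_zero`, `card_segCubes`, `cap_spec`, `sum_polScalar_term_eq`, `sum_univ_expChart_term`, `abs_psi_sub_psi_le`, `exists_threshold_domCount`,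
`historyAmplitudes_admissible`, `not_eventuallyConst_polWindow_localizedSum_nestedTower`); g4∕g5 `exists_threshold_siteOfInt`; dag-n18-w2 `bondEval`, `fadingAmp`; Literature def-T
`TreeLengthTorus.torusTreeLen_le_card_sub_one`, `B12Decay510Torus.{distCT, nearT, tcubeOf, pl1, distCT_le, nearT_le, distCT_nonneg}`, node00-def-β `Beta.RemainderLimitTorus.tcubeOf_zero`, `B12TreeDecay.{K₀, kappa₀, K₀_pos}`.

HONEST FRAMING (binding).  A MODEL-LEVEL A6 witness of the JOINT SATISFIABILITY of p607522's rows by non-trivial data (test activities on def-T's catalogue reading ONE bond, scalar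
probe algebra `𝔄 = ℝ`, `ρ = id`, one colour; `Ec = ℂ`): NOT Bałaban's activities (2.9)–(2.11), NOT the towers, readings, minimizers or admissible spaces OF RECORD; the (2.38) slot, the
activity holomorphy, the p. 282 tails and (S≈) are DISCHARGED FOR THE MODEL ONLY and STAY displayed hypotheses with their owners (N10 ∕ NODE A ∕ def-W1) at the record; nothing of
Bałaban's asserted or constructed; (1.21)'s existence for the terms OF RECORD NOT proved; N22 NOT discharged; K3⁸ `SpineGivenEndpointR13SepCoPHV` OPEN, not claimed, no stub touched;
counts UNMOVED (the chair's single count line is the only count); one finite 𝕋⁴ programme at fixed ε — R4 closes the CONDITIONAL rung `BalabanLadder.UV` only; NOTHING about the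
continuum limit, ℝ⁴, OS axioms or a mass gap is proved or claimed; the Yang–Mills mass gap (Clay) is NOT proved by any of this.  No cite tags (Summit side); TYPES only: [I] =
[Balaban1987RG1] CMP **109** (1987) (1.7) p. 261, (1.20)–(1.21) p. 264, p. 282; [II] = [Balaban1988RG2Cluster] CMP **116** (1988) (2.13)–(2.14) pp. 14–15, (2.30) p. 18, Lemma 3 (2.38) p. 20.
-/

noncomputable section

open Finset Filter Topology Metric
open scoped BigOperators

namespace YMDAG.N22.AtKernels.NestedPolymers

open Literature.Probability.LatticeModels
open Literature.MathematicalPhysics.QuantumFieldTheory.Balaban1983to89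
open Literature.MathematicalPhysics.QuantumFieldTheory.Balaban1983to89.TreeLengthTorus (TPt TFaceConnected IsTDom TDom tsys torusTreeLen torusTreeLen_le_card_sub_one)
open Literature.MathematicalPhysics.QuantumFieldTheory.Balaban1983to89.T4Continuum (T4Family)
open Literature.MathematicalPhysics.QuantumFieldTheory.Balaban1983to89.Node00 (siteOfInt polScalar polWindow polLimit PolLimitExists TermFamily1)
open Literature.MathematicalPhysics.QuantumFieldTheory.Balaban1983to89.Node00.Sect2 (domSys domCount CPair)
open Literature.MathematicalPhysics.QuantumFieldTheory.Balaban1983to89.Node00.W1 (ClusterStep ClusterTower)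
open Literature.MathematicalPhysics.QuantumFieldTheory.Balaban1983to89.Node00.LocalizedSum17 (localizedSum ReadingMaps)
open Literature.MathematicalPhysics.QuantumFieldTheory.Balaban1983to89.Node00.U3KernelLetters (PolLimitsExist)
open Literature.MathematicalPhysics.QuantumFieldTheory.Balaban1983to89.Node00.U3OfKernels (histPrefix)
open Literature.MathematicalPhysics.QuantumFieldTheory.Balaban1983to89.B12Decay510Torus (distCT nearT distCT_nonneg distCT_le nearT_le tcubeOf pl1 pl1_eq_sum pabs)
open Literature.MathematicalPhysics.QuantumFieldTheory.Balaban1983to89.B12TreeDecay (K₀ kappa₀ K₀_pos kappa₀_nonneg)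
open YMDAG.N18.FiniteVolumeLettersModel (bondEval bondEval_apply)
open YMDAG.N22.AtKernels.NestedTermsModel (exists_threshold_siteOfInt)
open Literature.MathematicalPhysics.QuantumFieldTheory.Balaban1983to89.B12PolarizationTensor120 (expChart)

/-! ## §0 Geometry of the window origin on def-T's torus: the fine site `0` lies in the cube `0`, at distance `0` from every domain containing that cube -/

section Geometry

variable {d N M : ℕ} [NeZero N] [NeZero M]

/-- The periodic ℓ¹ length of the zero site vanishes. -/
theorem pl1_zero {T : ℕ} : pl1 (0 : TPt d T) = 0 := by
  simp [pl1_eq_sum, pabs]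

/-- The distance from the fine site `0` to its own cube is `0` (the site `0` lies in the cube `0`: node00-def-β's `Beta.RemainderLimitTorus.tcubeOf_zero`). -/
theorem distCT_zero_zero : distCT N M (0 : TPt d (N * M)) (0 : TPt d N) = 0 :=
  le_antisymm ((distCT_le (p := 0) (q := 0) Beta.RemainderLimitTorus.tcubeOf_zero).trans (by rw [sub_zero, pl1_zero])) (distCT_nonneg _ _)

/-- **dist(0, X) = 0 for every domain containing the origin cube**: the p. 282 site weight `B₃e^{−δ₀·dist(0, X)}` at the window origin is `B₃` there. -/
theorem distCT_nearT_zero_eq_zero (X : TDom d N) (h0 : (0 : TPt d N) ∈ X.1) :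
    distCT N M (0 : TPt d (N * M)) (nearT (M := M) (0 : TPt d (N * M)) X) = 0 :=
  le_antisymm ((nearT_le (M := M) 0 X h0).trans distCT_zero_zero.le) (distCT_nonneg _ _)

end Geometry

section Origin

variable (F : T4Family) (M : ℕ) [NeZero M]

/-- The window origin `siteOfInt F K j 0`, embedded in the fine torus of def-T's site geometry (the cast of p607522's `hwB`∕`hlo` rows), is the site `0`. -/
theorem cast_siteOfInt_zero (K j N : ℕ) :
    (fun i => (ZMod.cast ((siteOfInt F K j 0) i) : ZMod N)) = (0 : TPt (F.P K).d N) := by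
  funext i
  simp [siteOfInt]

end Origin

/-! ## §1 The rows of p607522 at the nested tower: W1's (2.38) value slot, activity holomorphy through the smeared chart, the weighted origin probe -/

section Slots

variable (F : T4Family) (M : ℕ)

/-- ★ **W1's (2.38) VALUE SLOT `Bound238` HOLDS FOR THE NESTED TOWER** on the admissible spaces «`|𝐔(b₀)| ≤ e^r` whenever the domain contains the origin cube» (`b₀` = the bond
`(e₀, 0)` the activities read), for amplitudes `0 ≤ a k i ≤ A e^{−r} e^{−R i}` (`A, R ≥ 0`): the activity of the polymer `seg i` is `a k i · 𝐔(b₀)`, of modulus `≤ A e^{−R i} ≤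
A e^{−R d(seg i)}` since def-T's tree length of the straight chain of `i + 1` cubes is `≤ i` ((2.30) upper half `torusTreeLen_le_card_sub_one`); every other domain carries no activity. -/
theorem bound238_nestedTower {a : (k : ℕ) → ℕ → (Fin (k + 1) → ℝ) → ℝ} (ha : ∀ k i g, 0 ≤ a k i g) {A R r : ℝ} (hA : 0 ≤ A) (hR : 0 ≤ R)
    (hbd : ∀ k i g, a k i g ≤ A * Real.exp (-r) * Real.exp (-R) ^ i) (K k : ℕ) (Wk : Set (Fin (k + 1) → ℝ)) :
    ((nestedTower F M a K) k).Bound238 Wk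
      (fun Z => {φ : CPair (F.P K) ℂ | (0 : TPt (F.P K).d (domCount (F.P K) M (k + 1))) ∈ Z.1 → ‖φ.1 ⟨default, Fin.cast (F.P_d K).symm 0⟩‖ ≤ Real.exp r}) A R := by
  classical
  intro g _ Z φ hφ
  by_cases hZ : ∃ i ≤ min K (domCount (F.P K) M (k + 1) - 1), Z = segDom (domCount (F.P K) M (k + 1)) (Fin.cast (F.P_d K).symm 0) i
  · obtain ⟨i, hi, rfl⟩ := hZ
    have hn := cap_spec K (domCount (F.P K) M (k + 1))
    have hH : ((nestedTower F M a K) k).H g φ (segDom (domCount (F.P K) M (k + 1)) (Fin.cast (F.P_d K).symm 0) i) =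
        (a k i g : ℂ) * φ.1 ⟨default, Fin.cast (F.P_d K).symm 0⟩ :=
      H_nestedStep_segDom _ _ hn g φ hi
    have hφ0 : ‖φ.1 ⟨default, Fin.cast (F.P_d K).symm 0⟩‖ ≤ Real.exp r := hφ (zero_mem_segCubes _ i)
    have hd : (domSys (F.P K) M (k + 1)).dj (segDom (domCount (F.P K) M (k + 1)) (Fin.cast (F.P_d K).symm 0) i) ≤ i := by
      have hc := card_segCubes (n := domCount (F.P K) M (k + 1)) (Fin.cast (F.P_d K).symm 0) (i := i) (by omega)
      have h := torusTreeLen_le_card_sub_one (segCubes_nonempty (n := domCount (F.P K) M (k + 1)) (Fin.cast (F.P_d K).symm 0) i) (tFaceConnected_segCubes _ i)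
      rw [hc] at h
      push_cast at h
      show torusTreeLen (segCubes (domCount (F.P K) M (k + 1)) (Fin.cast (F.P_d K).symm 0) i) ≤ (i : ℝ)
      linarith
    have h1 : Real.exp (-r) * Real.exp r = 1 := by rw [← Real.exp_add, neg_add_cancel, Real.exp_zero]
    rw [hH, norm_mul, Complex.norm_real, Real.norm_of_nonneg (ha k i g)]
    calc a k i g * ‖φ.1 ⟨default, Fin.cast (F.P_d K).symm 0⟩‖ ≤ A * Real.exp (-r) * Real.exp (-R) ^ i * Real.exp r :=
          mul_le_mul (hbd k i g) hφ0 (norm_nonneg _) (by positivity)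
      _ = A * Real.exp (-R) ^ i * (Real.exp (-r) * Real.exp r) := by ring
      _ = A * Real.exp (-(R * i)) := by rw [h1, mul_one, ← Real.exp_nat_mul]; congr 2; ring
      _ ≤ A * Real.exp (-(R * (domSys (F.P K) M (k + 1)).dj (segDom (domCount (F.P K) M (k + 1)) (Fin.cast (F.P_d K).symm 0) i))) :=
          mul_le_mul_of_nonneg_left (Real.exp_le_exp.2 (neg_le_neg (mul_le_mul_of_nonneg_left hd hR))) hA
  · push Not at hZ
    rw [show ((nestedTower F M a K) k).H g φ Z = 0 from H_nestedStep_eq_zero _ _ _ g φ hZ, norm_zero]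
    positivity

/-- ★ **ACTIVITY HOLOMORPHY THROUGH A SMEARED EXPONENTIAL CHART**: for every `c ∈ ℂ` and every domain `Z`, the activity `z ↦ H(Z; hist; (exp(c z) smeared, 0))` of the nested tower is
holomorphic on every set (it is `a k i hist · e^{c z}` on the polymers `seg i`, `0` elsewhere) — the row `hHhol` of p607522 ([I] p. 264 ∕ [II] p. 15 shape). -/
theorem differentiableOn_H_nestedTower (a : (k : ℕ) → ℕ → (Fin (k + 1) → ℝ) → ℝ) (K k : ℕ) (hist : Fin (k + 1) → ℝ) (Z : (domSys (F.P K) M (k + 1)).Dom) (c : ℂ) (s : Set ℂ) :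
    DifferentiableOn ℂ (fun z : ℂ => ((nestedTower F M a K) k).H hist ((fun _ => Complex.exp (c * z)), (fun _ => 0)) Z) s := by
  classical
  by_cases hZ : ∃ i ≤ min K (domCount (F.P K) M (k + 1) - 1), Z = segDom (domCount (F.P K) M (k + 1)) (Fin.cast (F.P_d K).symm 0) i
  · obtain ⟨i, hi, rfl⟩ := hZ
    have hH : ∀ z : ℂ, ((nestedTower F M a K) k).H hist ((fun _ => Complex.exp (c * z)), (fun _ => 0))
        (segDom (domCount (F.P K) M (k + 1)) (Fin.cast (F.P_d K).symm 0) i) = (a k i hist : ℂ) * Complex.exp (c * z) := fun z =>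
      H_nestedStep_segDom _ _ (cap_spec K _) hist _ hi
    refine DifferentiableOn.congr ?_ (fun z _ => hH z)
    exact ((differentiable_const _).mul (Complex.differentiable_exp.comp ((differentiable_const c).mul differentiable_id))).differentiableOn
  · push Not at hZ
    refine DifferentiableOn.congr (differentiableOn_const (0 : ℂ)) (fun z _ => ?_)
    exact H_nestedStep_eq_zero _ _ _ hist _ hZ

/-- Un-weighting a weighted real reading inside the exponential: `exp(e^{c} · (e^{−c} x)) = e^x` (read in `ℂ`) — the chart clause `Φ (ιc B) = emb (exp ρB)` of p607522 for the
`δ₀`-weighted origin probe and the smeared chart. -/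
theorem cexp_weight_unweight (c x : ℝ) : Complex.exp (((Real.exp c : ℝ) : ℂ) * ((Real.exp (-c)) • ((x : ℝ) : ℂ))) = ((Real.exp x : ℝ) : ℂ) := by
  rw [Complex.real_smul, ← mul_assoc, ← Complex.ofReal_mul, ← Real.exp_add, add_neg_cancel, Real.exp_zero, Complex.ofReal_one, one_mul,
    Complex.ofReal_exp]

/-- `‖exp z‖ ≤ e^r` on the ball of radius `r`: the smeared chart maps the probe ball into the admissible space at a domain containing the origin cube. -/
theorem norm_cexp_le_of_mem_ball {z : ℂ} {r : ℝ} (hz : z ∈ ball (0 : ℂ) r) : ‖Complex.exp z‖ ≤ Real.exp r := by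
  rw [Complex.norm_exp]
  exact Real.exp_le_exp.2 ((Complex.re_le_norm z).trans (mem_ball_zero_iff.1 hz).le)

end Slots

/-! ## §2 (S≈) for the model: the window sums of def-W1's localized sum of the nested tower are geometrically Cauchy across consecutive volumes -/

section ApproxStable

variable (F : T4Family) (M : ℕ) [NeZero M]

/-- ★ **(S≈) — APPROXIMATE CROSS-VOLUME STABILITY OF THE MODEL'S WINDOW SUMS** (p607522's displayed law, class «every domain small»): for amplitudes `0 ≤ a k i ≤ Λ q^i`
(`0 ≤ q ≤ 1`), from a volume threshold on the sums over ALL domains of the per-term scalar kernels at the window sites of the tori `K + 1` and `K` differ by at most `Λ q^K` —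
both are `[μ = ν = 0][z = 0]·ψ(Σ_{i ≤ cap} a k i)` (`ψ(A) = A∕(1+A)²`, caps `K + 1` and `K` from the threshold on), and `|ψ(A) − ψ(B)| ≤ |A − B| = a k (K+1) ≤ Λ q^{K+1} ≤ Λ q^K`. -/
theorem approxStable_localizedSum_nestedTower {a : (k : ℕ) → ℕ → (Fin (k + 1) → ℝ) → ℝ} (ha : ∀ k i g, 0 ≤ a k i g) {Λ q : ℝ} (hq : 0 ≤ q) (hq1 : q ≤ 1)
    (hbd : ∀ k i g, a k i g ≤ Λ * q ^ i) (g : ℕ → ℝ) (k : ℕ) (μ ν : Fin 4) (z : Fin 4 → ℤ) :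
    ∃ (K₀ : ℕ) (C : ℝ), ∀ K : ℕ, K₀ ≤ K →
      |∑ X : (domSys (F.P (K + 1)) M (k + 1)).Dom, polScalar (fun U' : Fin (F.P (K + 1)).d → Site (F.P (K + 1)) (k + 1) → ℝ =>
            (((nestedTower F M a (K + 1)) k).E (histPrefix g k) (originReading F (K + 1) k U') X).re) (ContinuousLinearMap.id ℝ ℝ) (Module.Basis.singleton Unit ℝ)
            (Fin.cast (F.P_d (K + 1)).symm μ) (siteOfInt F (K + 1) (k + 1) z) (Fin.cast (F.P_d (K + 1)).symm ν) (siteOfInt F (K + 1) (k + 1) 0) -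
        ∑ X : (domSys (F.P K) M (k + 1)).Dom, polScalar (fun U' : Fin (F.P K).d → Site (F.P K) (k + 1) → ℝ =>
            (((nestedTower F M a K) k).E (histPrefix g k) (originReading F K k U') X).re) (ContinuousLinearMap.id ℝ ℝ) (Module.Basis.singleton Unit ℝ)
            (Fin.cast (F.P_d K).symm μ) (siteOfInt F K (k + 1) z) (Fin.cast (F.P_d K).symm ν) (siteOfInt F K (k + 1) 0)| ≤ C * q ^ K := by
  classical
  obtain ⟨K₁, hK₁⟩ := exists_threshold_domCount (F := F) (M := M) k
  obtain ⟨K₂, hK₂⟩ := exists_threshold_siteOfInt F (k + 1) z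
  have hΛ : 0 ≤ Λ := (ha 0 0 0).trans (by simpa using hbd 0 0 0)
  refine ⟨max K₁ K₂, Λ, fun K hK => ?_⟩
  have hK1 : K₁ ≤ K := (le_max_left _ _).trans hK
  have hK2 : K₂ ≤ K := (le_max_right _ _).trans hK
  have hmK : min K (domCount (F.P K) M (k + 1) - 1) = K := by have := hK₁ K hK1; omega
  have hmK' : min (K + 1) (domCount (F.P (K + 1)) M (k + 1) - 1) = K + 1 := by have := hK₁ (K + 1) (by omega); omega
  have hA : ∀ j, 0 ≤ ∑ i ∈ Finset.range j, a k i (histPrefix g k) := fun j => Finset.sum_nonneg fun i _ => ha k i _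
  obtain ⟨hw, hw'⟩ := hK₂ K hK2
  rw [sum_polScalar_term_eq F M ha (K + 1) k _ Finset.univ (hA (K + 1 + 1)) (fun B => by rw [sum_univ_expChart_term F M ha (K + 1) k, hmK']) μ ν z,
    sum_polScalar_term_eq F M ha K k _ Finset.univ (hA (K + 1)) (fun B => by rw [sum_univ_expChart_term F M ha K k, hmK]) μ ν z,
    if_congr (and_congr Iff.rfl (and_congr Iff.rfl hw')) rfl rfl, if_congr (and_congr Iff.rfl (and_congr Iff.rfl hw)) rfl rfl]
  split_ifs
  · refine (abs_psi_sub_psi_le (hA _) (hA _)).trans ?_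
    rw [Finset.sum_range_succ, add_sub_cancel_left, abs_of_nonneg (ha _ _ _)]
    refine (hbd k (K + 1) _).trans ?_
    rw [pow_succ, ← mul_assoc]
    exact mul_le_of_le_one_right (mul_nonneg hΛ (pow_nonneg hq K)) hq1
  · rw [sub_self, abs_zero]; positivity

end ApproxStable

/-! ## §3 ★★★ p607522 fires at the nested tower: every one of its rows inhabited by the model, non-degenerately -/

section Fires

open YMDAG.N22.AtKernels (polLimitsExist_localizedSum_of_activitySlots)

variable (F : T4Family) (M : ℕ) [NeZero M]

/-- ★★★ **dag-n22-w3 g3's ACTIVITY-SLOT ∕ (S≈) EXISTENCE THEOREM FIRES AT def-W1's `localizedSum` OF THE NESTED-POLYMERS TOWER.**  For cubes of side `M = L^{m′}`, amplitudes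
`0 ≤ a k i ≤ A e^{−r} e^{−R i}` and ANY Road-1 numerals `(A, R, r₁, κ)` meeting p607522's rows (`A ≥ 0`, `0 < κ ≤ r₁`, `κ₀(64,8) ≤ κ∕4`, `r₁ + 128 log 162 + 2 ≤ R`,
`A e^{5r₁+1}K₀(64,8)·9·64 ≤ 1`; inhabited with `A > 0`, `roadOne_numerals_pos`), any `δ₀ > 0`, `r > 0` and any window `W`, EVERY hypothesis of
`polLimitsExist_localizedSum_of_activitySlots` (p607522) holds AT ONCE for the GENUINE `ClusterTower` `nestedTower F M a` read through `originReading F` at the NONZERO chart `ρ = id`: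
(slot) W1's (2.38) value bound on the admissible spaces «`|𝐔(b₀)| ≤ e^r` if the domain contains the origin cube» (`bound238_nestedTower`); (reading) the `δ₀`-WEIGHTED ORIGIN PROBE
`ιc K k X := e^{−δ₀·dist(0, X)} · (B ↦ B(e₀, 0))` into `Ec := ℂ`, the SMEARED CHART `Φ K k X z := (exp(e^{+δ₀·dist(0, X)} z) on every bond, 0)` on `U := ball 0 r` — so that
`Φ X (ιc X B) = originReading (exp B)` for EVERY domain `X` (`cexp_weight_unweight`), every activity holomorphic (`differentiableOn_H_nestedTower`), and `Φ X z` admissible at every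
`Z ⊆ X` since `dist(0, X) = 0` as soon as `X` contains the origin cube (`distCT_nearT_zero_eq_zero`); (tails) site weights `w K k X t := [t = 0]·e^{−δ₀·dist(0, X)}`, which MEET the
p. 282 row `w ≤ B₃e^{−δ₀ dist(t, X)}` with `B₃ = 1` (with equality at the origin); (S≈) with every domain «small», `r₀ := e^{−R}` (`approxStable_localizedSum_nestedTower`) — and the
theorem YIELDS W1-19b's letter `PolLimitsExist F (localizedSum F (nestedTower F M a) (originReading F)) id 𝟙 W`.  NON-DEGENERATE whenever `a > 0`: the window kernels at the origin
entry are then STRICTLY increasing in the volume (`polWindow_localizedSum_nestedTower_lt_succ`, `not_eventuallyConst_polWindow_localizedSum_nestedTower` of `…Limit`), the chart is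
not zero, the tower has terms — replacing the reach of p607522 §3's zero-tower ∕ zero-chart smoke test.  HONEST: a MODEL-level A6 witness of the joint satisfiability of p607522's
rows by non-trivial data; test activities, NOT Bałaban's; NOT the towers ∕ readings OF RECORD; (1.21) for the terms OF RECORD NOT proved; nothing of Bałaban's asserted. -/
theorem polLimitsExist_localizedSum_of_activitySlots_fires_nestedTower (m' : ℕ) (hM : M = F.L ^ m') {a : (k : ℕ) → ℕ → (Fin (k + 1) → ℝ) → ℝ} (ha : ∀ k i g, 0 ≤ a k i g)
    {A R r₁ κ r δ₀ : ℝ} (hA : 0 ≤ A) (hr₁ : 0 ≤ r₁) (hκ0 : 0 < κ) (hκ : κ ≤ r₁) (hκ4 : kappa₀ (4 * 2 ^ 4) (2 * 4) ≤ κ / 2 / 2) (hrate : r₁ + 2 * (64 * Real.log 162) + 2 ≤ R)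
    (hsmall : A * Real.exp (5 * r₁ + 1) * K₀ 64 8 * 9 * 64 ≤ 1) (hδ₀ : 0 < δ₀) (hr : 0 < r)
    (hbd : ∀ k i g, a k i g ≤ A * Real.exp (-r) * Real.exp (-R) ^ i) (W : Set (ℕ → ℝ)) :
    PolLimitsExist F (localizedSum F (nestedTower F M a) (originReading F)) (ContinuousLinearMap.id ℝ ℝ) (Module.Basis.singleton Unit ℝ) W := by
  classical
  have hR0 : 0 < R := by
    have : (0 : ℝ) ≤ 2 * (64 * Real.log 162) := by positivity
    linarith
  have hR : 0 ≤ R := hR0.le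
  -- the window origin on the fine torus of def-T's site geometry, and the distance from it to a domain
  let e : (K k : ℕ) → TPt (F.P K).d (domCount (F.P K) M (k + 1) * M) := fun K k i => (ZMod.cast ((siteOfInt F K (k + 1) 0) i) : ZMod (domCount (F.P K) M (k + 1) * M))
  let D : (K k : ℕ) → (domSys (F.P K) M (k + 1)).Dom → ℝ := fun K k X => distCT (domCount (F.P K) M (k + 1)) M (e K k) (nearT (M := M) (e K k) X)
  have he : ∀ K k, e K k = 0 := fun K k => cast_siteOfInt_zero F K (k + 1) _
  have hD0 : ∀ (K k : ℕ) (X : (domSys (F.P K) M (k + 1)).Dom), (0 : TPt (F.P K).d (domCount (F.P K) M (k + 1))) ∈ X.1 → D K k X = 0 := fun K k X h0 => by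
    show distCT (domCount (F.P K) M (k + 1)) M (e K k) (nearT (M := M) (e K k) X) = 0
    rw [he]
    exact distCT_nearT_zero_eq_zero X h0
  refine polLimitsExist_localizedSum_of_activitySlots F m' M hM (nestedTower F M a) (originReading F) (ContinuousLinearMap.id ℝ ℝ) (Module.Basis.singleton Unit ℝ) W
    (fun _ _ => Set.univ) (fun _ _ _ _ => Set.mem_univ _)
    (fun K k Z => {φ : CPair (F.P K) ℂ | (0 : TPt (F.P K).d (domCount (F.P K) M (k + 1))) ∈ Z.1 → ‖φ.1 ⟨default, Fin.cast (F.P_d K).symm 0⟩‖ ≤ Real.exp r})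
    (A := A) (R := R) (r₁ := r₁) (κ := κ) (B₃ := 1) (δ₀ := δ₀) (r := r) (r₀ := Real.exp (-R))
    hA hr₁ hκ0 hκ hκ4 hrate hsmall zero_le_one hδ₀ hr
    (fun K k => bound238_nestedTower F M ha hA hR hbd K k _)
    (fun _ _ => ℂ)
    (fun K k X => (Real.exp (-(δ₀ * D K k X))) • (Complex.ofRealCLM.comp (bondEval (Fin.cast (F.P_d K).symm 0) (siteOfInt F K (k + 1) 0))))
    (fun K k X z => ((fun _ => Complex.exp (((Real.exp (δ₀ * D K k X) : ℝ) : ℂ) * z)), (fun _ => 0)))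
    (fun _ _ _ => ball (0 : ℂ) r) (fun _ _ _ => isOpen_ball) (fun _ _ _ => subset_rfl)
    (fun K k hist _ X Z _ => differentiableOn_H_nestedTower F M a K k hist Z _ _)
    (fun K k X B => Prod.ext (funext fun _ => ?_) rfl)
    (fun K k X z hz Z hZX h0 => ?_)
    (fun K k X t => if t = siteOfInt F K (k + 1) 0 then Real.exp (-(δ₀ * D K k X)) else 0)
    (fun K k X t => by positivity)
    (fun K k X l t c => ?_) (fun K k X t => ?_)
    (fun _ _ _ => True) (fun _ _ _ h => (h trivial).elim) (Real.exp_lt_one_iff.2 (by linarith)) (Real.exp_pos _).le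
    (fun g _ k μ ν z => by simpa only [Finset.filter_true] using approxStable_localizedSum_nestedTower F M ha (Real.exp_pos _).le (Real.exp_le_one_iff.2 (by linarith)) hbd g k μ ν z)
  · -- chart clause: `Φ X (ιc X B) = originReading (exp B)` for EVERY domain `X`
    rw [originReading_fst]
    show Complex.exp (((Real.exp (δ₀ * D K k X) : ℝ) : ℂ) *
        ((Real.exp (-(δ₀ * D K k X))) • (((bondEval (Fin.cast (F.P_d K).symm 0) (siteOfInt F K (k + 1) 0) B : ℝ)) : ℂ))) = _
    rw [bondEval_apply, cexp_weight_unweight, Real.exp_eq_exp_ℝ]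
    rfl
  · -- space clause: at a domain `Z ⊆ X` containing the origin cube, `dist(0, X) = 0` and `‖exp z‖ ≤ e^r` on the ball
    show ‖Complex.exp (((Real.exp (δ₀ * D K k X) : ℝ) : ℂ) * z)‖ ≤ Real.exp r
    rw [hD0 K k X (hZX h0), mul_zero, Real.exp_zero, Complex.ofReal_one, one_mul]
    exact norm_cexp_le_of_mem_ball hz
  · -- site weights of the weighted origin probe
    rw [Module.Basis.singleton_apply, smul_apply, ContinuousLinearMap.comp_apply, bondEval_apply, Complex.ofRealCLM_apply, norm_smul, Complex.norm_real,
      Real.norm_of_nonneg (Real.exp_pos _).le]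
    by_cases ht : t = siteOfInt F K (k + 1) 0
    · subst ht
      rw [if_pos rfl]
      refine mul_le_of_le_one_right (Real.exp_pos _).le ?_
      by_cases hl : Fin.cast (F.P_d K).symm 0 = l
      · subst hl; simp
      · rw [Pi.single_eq_of_ne hl]; simp
    · rw [if_neg ht]
      by_cases hl : Fin.cast (F.P_d K).symm 0 = l
      · subst hl; rw [Pi.single_eq_same, Pi.single_eq_of_ne (Ne.symm ht), norm_zero, mul_zero]
      · rw [Pi.single_eq_of_ne hl, Pi.zero_apply, norm_zero, mul_zero]
  · -- the p. 282 tails row, met with `B₃ = 1` (equality at the origin)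
    split_ifs with ht
    · subst ht
      rw [one_mul, neg_mul]
    · positivity

/-- ★ **THE ROAD-1 NUMERAL ROWS OF p607522 ARE INHABITED WITH A POSITIVE AMPLITUDE**: `κ := r₁ := 4κ₀(64,8) + 1`, `R := r₁ + 128 log 162 + 2`,
`A := (e^{5r₁+1}K₀(64,8)·9·64)⁻¹ > 0` (p607522 §3's `kappa_four_smoke` took `A := 0`). -/
theorem roadOne_numerals_pos : ∃ A R r₁ κ : ℝ, 0 < A ∧ 0 ≤ r₁ ∧ 0 < κ ∧ κ ≤ r₁ ∧ kappa₀ (4 * 2 ^ 4) (2 * 4) ≤ κ / 2 / 2 ∧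
    r₁ + 2 * (64 * Real.log 162) + 2 ≤ R ∧ A * Real.exp (5 * r₁ + 1) * K₀ 64 8 * 9 * 64 ≤ 1 := by
  obtain ⟨h0, h4⟩ := YMDAG.N22.AtKernels.kappa_four_smoke
  have hK := K₀_pos 64 8
  have hP : 0 < Real.exp (5 * (4 * kappa₀ (4 * 2 ^ 4) (2 * 4) + 1) + 1) * K₀ 64 8 * 9 * 64 := by positivity
  refine ⟨(Real.exp (5 * (4 * kappa₀ (4 * 2 ^ 4) (2 * 4) + 1) + 1) * K₀ 64 8 * 9 * 64)⁻¹, _, 4 * kappa₀ (4 * 2 ^ 4) (2 * 4) + 1,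
    4 * kappa₀ (4 * 2 ^ 4) (2 * 4) + 1, inv_pos.2 hP, h0.le, h0, le_rfl, h4, le_rfl, le_of_eq ?_⟩
  calc (Real.exp (5 * (4 * kappa₀ (4 * 2 ^ 4) (2 * 4) + 1) + 1) * K₀ 64 8 * 9 * 64)⁻¹ * Real.exp (5 * (4 * kappa₀ (4 * 2 ^ 4) (2 * 4) + 1) + 1) * K₀ 64 8 * 9 * 64
        = (Real.exp (5 * (4 * kappa₀ (4 * 2 ^ 4) (2 * 4) + 1) + 1) * K₀ 64 8 * 9 * 64)⁻¹ * (Real.exp (5 * (4 * kappa₀ (4 * 2 ^ 4) (2 * 4) + 1) + 1) * K₀ 64 8 * 9 * 64) := by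
          ring
    _ = 1 := inv_mul_cancel₀ hP.ne'

open YMDAG.N18.FiniteVolumeLettersModel (fadingAmp) in
/-- ★★ **NON-DEGENERATE FIRING WITH COUPLING-READING AMPLITUDES.**  For ANY numerals meeting p607522's rows with `A > 0` (`roadOne_numerals_pos`), any `δ₀ > 0`, `r > 0`, `ω ≥ 0` and
any window `W`, the COUPLING-READING amplitude `a k i h := (A ⊓ 1)e^{−r} · (1 − q)q^i∕4 · (1 + clamp(fadingAmp ω k h))`, `q := e^{−R}` (this seat's `historyAmplitudes_admissible`
family of `…N22`, scaled into the (2.38) slot) is STRICTLY POSITIVE, meets the slot row `a ≤ A e^{−r} e^{−R i}`, so p607522 FIRES for it (`polLimitsExist_localizedSum_of_activitySlots_fires_nestedTower`)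
— AND the windowed kernels of def-W1's localized sum of this tower at the origin entry are NOT eventually constant in the volume (`not_eventuallyConst_polWindow_localizedSum_nestedTower` of
`…Limit`: partial sums `≤ (A ⊓ 1)e^{−r} ≤ 1`, amplitudes `> 0`): a genuinely volume-dependent, convergent window kernel obtained THROUGH the activity-slot theorem.  MODEL LEVEL. -/
theorem polLimitsExist_localizedSum_of_activitySlots_fires_nestedTower_couplingAmplitudes (m' : ℕ) (hM : M = F.L ^ m') {A R r₁ κ r δ₀ ω : ℝ} (hA : 0 < A) (hr₁ : 0 ≤ r₁)
    (hκ0 : 0 < κ) (hκ : κ ≤ r₁) (hκ4 : kappa₀ (4 * 2 ^ 4) (2 * 4) ≤ κ / 2 / 2) (hrate : r₁ + 2 * (64 * Real.log 162) + 2 ≤ R) (hsmall : A * Real.exp (5 * r₁ + 1) * K₀ 64 8 * 9 * 64 ≤ 1)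
    (hδ₀ : 0 < δ₀) (hr : 0 < r) (hω : 0 ≤ ω) (W : Set (ℕ → ℝ)) :
    let a : (k : ℕ) → ℕ → (Fin (k + 1) → ℝ) → ℝ := fun k i h =>
      min A 1 * Real.exp (-r) * ((1 - Real.exp (-R)) * Real.exp (-R) ^ i / 4 * (1 + max (min (fadingAmp ω k h) 1) 0))
    (∀ k i h, 0 < a k i h) ∧
      PolLimitsExist F (localizedSum F (nestedTower F M a) (originReading F)) (ContinuousLinearMap.id ℝ ℝ) (Module.Basis.singleton Unit ℝ) W ∧
      ∀ (k : ℕ) (hist : Fin (k + 1) → ℝ), ¬ ∃ (K₀ : ℕ) (P : ℝ), ∀ K : ℕ, K₀ ≤ K →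
        polWindow F K (k + 1) (localizedSum F (nestedTower F M a) (originReading F) k hist K) (ContinuousLinearMap.id ℝ ℝ) (Module.Basis.singleton Unit ℝ) 0 0 0 = P := by
  intro a
  have hR0 : 0 < R := by
    have : (0 : ℝ) ≤ 2 * (64 * Real.log 162) := by positivity
    linarith
  have hq0 : 0 < Real.exp (-R) := Real.exp_pos _
  have hq1 : Real.exp (-R) < 1 := Real.exp_lt_one_iff.2 (by linarith)
  obtain ⟨h1, -, h3, -, -⟩ := historyAmplitudes_admissible (q := Real.exp (-R)) hq0 hq1 hω
  have hc : 0 < min A 1 * Real.exp (-r) := mul_pos (lt_min hA one_pos) (Real.exp_pos _)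
  have hpos : ∀ k i h, 0 < a k i h := fun k i h => mul_pos hc (h1 k i h)
  have hbd : ∀ k i h, a k i h ≤ A * Real.exp (-r) * Real.exp (-R) ^ i := fun k i h => by
    have hcl : max (min (fadingAmp ω k h) 1) 0 ≤ 1 := max_le (min_le_right _ _) zero_le_one
    have hc0 : 0 ≤ max (min (fadingAmp ω k h) 1) 0 := le_max_right _ _
    have hqi : 0 ≤ Real.exp (-R) ^ i := pow_nonneg hq0.le i
    have hcl' : (1 - Real.exp (-R)) * Real.exp (-R) ^ i / 4 * (1 + max (min (fadingAmp ω k h) 1) 0) ≤ Real.exp (-R) ^ i := by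
      nlinarith [mul_nonneg (sub_nonneg.2 hq1.le) hqi, mul_le_mul_of_nonneg_left hcl hqi, mul_nonneg hq0.le hqi]
    calc a k i h ≤ min A 1 * Real.exp (-r) * Real.exp (-R) ^ i := mul_le_mul_of_nonneg_left hcl' hc.le
      _ ≤ A * Real.exp (-r) * Real.exp (-R) ^ i := by gcongr; exact min_le_left _ _
  have hsum : ∀ k h j, ∑ i ∈ Finset.range j, a k i h ≤ 1 := fun k h j => by
    show ∑ i ∈ Finset.range j, min A 1 * Real.exp (-r) * ((1 - Real.exp (-R)) * Real.exp (-R) ^ i / 4 * (1 + max (min (fadingAmp ω k h) 1) 0)) ≤ 1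
    rw [← Finset.mul_sum]
    calc min A 1 * Real.exp (-r) * ∑ i ∈ Finset.range j, (1 - Real.exp (-R)) * Real.exp (-R) ^ i / 4 * (1 + max (min (fadingAmp ω k h) 1) 0)
        ≤ min A 1 * Real.exp (-r) * 1 := mul_le_mul_of_nonneg_left (h3 k h j) hc.le
      _ ≤ 1 * 1 * 1 := by gcongr; exacts [min_le_right _ _, Real.exp_le_one_iff.2 (by linarith)]
      _ = 1 := by norm_num
  exact ⟨hpos, polLimitsExist_localizedSum_of_activitySlots_fires_nestedTower F M m' hM (fun k i h => (hpos k i h).le) hA.le hr₁ hκ0 hκ hκ4 hrate hsmall hδ₀ hr hbd W,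
    fun k hist => not_eventuallyConst_polWindow_localizedSum_nestedTower F M hpos hsum k hist⟩

end Fires


end YMDAG.N22.AtKernels.NestedPolymers

end
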